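import Literature.Analysis.Potential.ArcsineHookEnergy
import Literature.Analysis.Potential.LogEnergyLayers
import Literature.RepresentationTheory.FiniteGroups.VershikKerovUpperReduction
import Literature.RepresentationTheory.FiniteGroups.VershikKerovBoundaryWord
import Mathlib.MeasureTheory.Function.Floor
import HarnessLib

/-!
# The Vershik–Kerov upper bound: the limit-shape expansion for lattice diagrams, and the discharge
# of `VershikKerov1985_maxCharDegree`

Topic `Literature/RepresentationTheory/FiniteGroups`; fourth file on the named fact
`VershikKerov1985_maxCharDegree` (`VershikKerovMaxDegree.lean`; Vershik–Kerov 1985, as quoted by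
Pak–Panova–Yeliussizov 2019, §2.3: for every `ε > 0` and large `n`,
`√(n!) e^{-(c₁+ε)√n} ≤ D(n) ≤ √(n!) e^{-(c₂-ε)√n}`, `D(n) = maxCharDegree 𝔖ₙ`, `c₂ = (π-2)/π²`).
`VershikKerovUpperReduction.lean` reduced the fact to the inequality
`(LSVK) ∀ N ≥ 1, ∀ μ ⊢ N: J(μ) := ∑_{c ∈ μ} K(h(c)) ≥ ½(N log N - N) + S_N/16`.
This file PROVES (LSVK) (`lsvk_inequality`) and hence
**`VershikKerov1985_maxCharDegree_holds : VershikKerov1985_maxCharDegree`**.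

## The argument (Vershik–Kerov 1985, Lemmas 1–4 and §3), as organised here

Rotate the diagram of `μ ⊢ N` by 45° (unit steps at integers). Row `i` ends in a boundary segment
of slope `-1` over the slot `[d_i, d_i+1)`, `d_i = μ_i - i - 1` (`VershikKerov.downPos`), column `j` in
a segment of slope `+1` over `[u_j, u_j+1)`, `u_j = j - μ'_j` (`VershikKerov.upPos`); `{d_i} ⊔ {u_j} = ℤ`,
a cell `(i,j)` is exactly a pair `u_j < d_i` and its hook length is `d_i - u_j` (all in the tree's
`VershikKerovBoundaryWord.lean`; the windowed pigeonhole form `exists_downPos_or_upPos` is added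
here). Let `p` be the indicator of the ascending slots (`ascSlot`, `= (1+f')/2` for the boundary
function `f`) and `T(x,y) = 1{x<y} log (y-x)`, `𝔅(φ,χ) = ∬ T φ(x) χ(y)`
(`Literature/Analysis/Potential/ArcsineHookEnergy.lean`).

1. `J(μ) = 𝔅(p, 1-p)` (`sum_vkHookKernel_eq_hookForm`; each pair of slots contributes
   `∫₀¹∫₀¹ log (d - a + t - s) = K(d - a)`, `hookForm_slot_slot`) — Vershik–Kerov's Lemma 1 in the
   form `∑_c K(h_c) = ¼ ∬_{x<y} log(y-x)(1+f'(x))(1-f'(y))`.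
2. With `a = 2√N`, `F = F_a` the arcsine distribution function (`= (1+Ω_N')/2` for the limit shape
   `Ω_N`) and `η = p - F`: `𝔅(p,1-p) = 𝔅(F,1-F) + [𝔅(η,1-F) - 𝔅(F,η)] - 𝔅(η,η)`
   (`hookForm_expand`), and `𝔅(F, 1-F) = ½(N log N - N)` (`hookForm_arcsine`).
3. `∫ η = 0` (`R` ascending slots in `[-R,R)`, `integral_ascSlot`) and `∫ x η = 0` (the area of the
   diagram, `integral_id_mul_ascSlot`, against `∫_{-R}^{R} x F_a = R²/2 - a²/4`,
   `integral_id_mul_arcsineCDF`), `η ≥ 0` left of `-a`, `≤ 0` right of `a`; hence the linear term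
   is `≥ 0` (`integral_mul_arcsineLinPot_nonneg`: Vershik–Kerov's `θ̄ ≥ 0`, Lemma 4).
4. `-𝔅(η,η) = -½ ∬ ηη log|x-y|` (`hookForm_self_eq_half_logEnergy`)
   `≥ ½ ∫₀¹ s⁻² ∫(∫_x^{x+s} η)² ≥ ¼ ∑_k n_k²` (`LogEnergyLayers.lean`: positivity of the logarithmic
   energy of a neutral charge with its local `H^{1/2}` remainder — the lower-bound half of
   Vershik–Kerov's Lemma 3 — and the diagonal-slots bound of §3), where on each slot `[k,k+1)`,
   `-⌊2√N⌋ ≤ k < ⌊2√N⌋`, `p` is constant and `F` monotone, so `η` keeps a sign with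
   `|η| ≥ n_k = min(F(k), 1-F(k+1))`, and `∑_k n_k² = ¼ · 2 ∑_{j=1}^{⌊2√N⌋} ψ(j/2√N) = S_N/4`.
   So `-𝔅(η,η) ≥ S_N/16`, and `J(μ) ≥ ½(N log N - N) + 0 + S_N/16`.

## References

* A. M. Vershik, S. V. Kerov, *Asymptotic of the largest and the typical dimensions of irreducible
  representations of a symmetric group*, Funct. Anal. Appl. 19 (1985) 21–31. [VershikKerov1985]
* B. F. Logan, L. A. Shepp, Adv. Math. 26 (1977) 206–222.
* I. Pak, G. Panova, D. Yeliussizov, J. Combin. Theory Ser. A 165 (2019), arXiv:1804.04693, §2.3.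
* S. Mkrtchyan, Europ. J. Combin. 33 (2012), arXiv:1008.3854. [Mkrtchyan2012]

## Mathlib and tree

Mathlib: `YoungDiagram` (`rowLen`, `colLen`, `mem_iff_lt_rowLen/colLen`, `rowLen_anti`,
`transpose`), `Int.floor` (`Int.floor_eq_iff`, `Int.measurable_floor`), `Finset.eq_of_subset_of_card_le`,
`MeasureTheory.integral_prod`, `integral_prod_swap`, `Measure.prod_restrict`. Tree:
`Nat.Partition.youngDiagram`, `card_cells_youngDiagram`, `hookLength`, `card_transpose`
(`PartitionTableaux.lean`); `VershikKerov.downPos/upPos`, `mem_iff_upPos_lt_downPos`,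
`hookLength_eq_downPos_sub_upPos`, `upPos_ne_downPos`, `sum_rowLen_eq_card`, `sum_range_add_half`
(`VershikKerovBoundaryWord.lean`); `vkHookKernel`, `vkPsi`, `vkDiagSum`
(`VershikKerovHookIntegral.lean`); `vkJCells`, `VershikKerov1985_maxCharDegree_of_hookIntegral_bound`
(`VershikKerovUpperReduction.lean`); `upperLogKernel`, `arcsineCDF`, `hookForm_arcsine`,
`hookForm_linear_eq`, `integral_mul_arcsineLinPot_nonneg`, `integrable_upperLogKernel_mul_mul`
(`ArcsineHookEnergy.lean`); `integral_sq_div_sq_le_neg_logEnergy`,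
`sum_sq_div_two_le_integral_sq_div_sq`, `integrable_mul_mul_kernel`, `ae_fst_ne_snd`
(`LogEnergyLayers.lean`).
-/

noncomputable section

open _root_.MeasureTheory _root_.Set _root_.Filter intervalIntegral
open scoped Real Topology Interval BigOperators

namespace Literature.RepresentationTheory.FiniteGroups

open Literature.Analysis.Potential
open Literature.NumberTheory.DiophantineGeometry (hookLength one_le_hookLength)

/-! ### The Maya diagram of a Young diagram (tree: `VershikKerovBoundaryWord.lean`) — complements -/

open VershikKerov

variable (Y : YoungDiagram)

/-- `u_c ≤ c`. [folklore] -/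
theorem upPos_le (j : ℕ) : upPos Y j ≤ j := by
  simp only [upPos]; omega

/-- `-λ'_0 ≤ u_c`. [folklore] -/
theorem neg_le_upPos (j : ℕ) : -(Y.colLen 0 : ℤ) ≤ upPos Y j := by
  have h := Y.colLen_anti 0 j (Nat.zero_le j)
  simp only [upPos]; omega

/-- Columns right of the last are empty: `λ'_c = 0` for `c ≥ λ_0`. [folklore] -/
theorem colLen_eq_zero_of_rowLen_le {j : ℕ} (hj : Y.rowLen 0 ≤ j) : Y.colLen j = 0 := by
  by_contra h0
  have h1 : (0, j) ∈ Y := YoungDiagram.mem_iff_lt_colLen.mpr (Nat.pos_of_ne_zero h0)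
  have h2 := YoungDiagram.mem_iff_lt_rowLen.mp h1
  omega

/-- Empty columns: for `c ≥ λ_0`, `u_c = c`. [folklore] -/
theorem upPos_of_rowLen_le {j : ℕ} (hj : Y.rowLen 0 ≤ j) : upPos Y j = j := by
  simp [upPos, colLen_eq_zero_of_rowLen_le Y hj]

/-- **`{d_i} ⊔ {a_j} = ℤ`, coverage of a window**: if `R ≥ λ_0` and `R ≥ λ'_0` then every integer
in `[-R, R)` is `d_i` or `a_j` for some `i, j < R` (pigeonhole: `2R` distinct values in a window
of `2R` integers). [folklore] -/
theorem exists_downPos_or_upPos {R : ℕ} (hR₁ : Y.rowLen 0 ≤ R) (hR₂ : Y.colLen 0 ≤ R) {k : ℤ}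
    (hk : k ∈ Finset.Ico (-(R : ℤ)) R) :
    (∃ i < R, downPos Y i = k) ∨ ∃ j < R, upPos Y j = k := by
  classical
  set D : Finset ℤ := (Finset.range R).image (downPos Y) with hD
  set A : Finset ℤ := (Finset.range R).image (upPos Y) with hA
  have hDcard : D.card = R := by
    rw [hD, Finset.card_image_of_injective _ (downPos_strictAnti Y).injective, Finset.card_range]
  have hAcard : A.card = R := by
    rw [hA, Finset.card_image_of_injective _ (upPos_strictMono Y).injective, Finset.card_range]
  have hdisj : Disjoint D A := by
    rw [Finset.disjoint_left]
    intro k hkD hkA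
    obtain ⟨i, -, rfl⟩ := Finset.mem_image.mp hkD
    obtain ⟨j, -, hj⟩ := Finset.mem_image.mp hkA
    exact upPos_ne_downPos Y i j hj
  have hsub : D ∪ A ⊆ Finset.Ico (-(R : ℤ)) R := by
    intro k hk
    rw [Finset.mem_Ico]
    rcases Finset.mem_union.mp hk with h | h
    · obtain ⟨i, hi, rfl⟩ := Finset.mem_image.mp h
      have h1 := downPos_le Y i; have h2 := neg_le_downPos Y i
      have hi' := Finset.mem_range.mp hi
      constructor <;> omega
    · obtain ⟨j, hj, rfl⟩ := Finset.mem_image.mp h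
      have h1 := upPos_le Y j; have h2 := neg_le_upPos Y j
      have hj' := Finset.mem_range.mp hj
      constructor <;> omega
  have hcard : (Finset.Ico (-(R : ℤ)) R).card ≤ (D ∪ A).card := by
    rw [Finset.card_union_of_disjoint hdisj, hDcard, hAcard, Int.card_Ico]
    omega
  have heq : D ∪ A = Finset.Ico (-(R : ℤ)) R := Finset.eq_of_subset_of_card_le hsub hcard
  rw [← heq] at hk
  rcases Finset.mem_union.mp hk with h | h
  · obtain ⟨i, hi, rfl⟩ := Finset.mem_image.mp h
    exact Or.inl ⟨i, Finset.mem_range.mp hi, rfl⟩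
  · obtain ⟨j, hj, rfl⟩ := Finset.mem_image.mp h
    exact Or.inr ⟨j, Finset.mem_range.mp hj, rfl⟩

/-! ### Slot indicators (the slopes of the rotated boundary) -/

variable {Y}

/-- **Ascending-slot indicator** (window `R`): `p(x) = 1` if the unit slot `[⌊x⌋, ⌊x⌋+1)` carries
an ascending segment of the rotated boundary — `⌊x⌋` is an ascent position `a_j`, `j < R`, or
`⌊x⌋ ≥ R` (the ray `y = x`) — else `0`; equals `(1 + f')/2` for the boundary function `f` when
`R ≥ λ_0, λ'_0`. [cite: VershikKerov1985, §1] -/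
def ascSlot (Y : YoungDiagram) (R : ℕ) (x : ℝ) : ℝ :=
  if ⌊x⌋ ∈ (Finset.range R).image (upPos Y) ∨ (R : ℤ) ≤ ⌊x⌋ then 1 else 0

/-- **Descending-slot indicator** (window `R`): `q(x) = 1` if `⌊x⌋` is a descent position `d_i`,
`i < R`, or `⌊x⌋ < -R` (the ray `y = -x`); equals `(1 - f')/2`. [cite: VershikKerov1985, §1] -/
def descSlot (Y : YoungDiagram) (R : ℕ) (x : ℝ) : ℝ :=
  if ⌊x⌋ ∈ (Finset.range R).image (downPos Y) ∨ ⌊x⌋ < -(R : ℤ) then 1 else 0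

/-- Measurability of a predicate of `⌊x⌋`. [folklore] -/
theorem measurableSet_floor_mem (P : Set ℤ) : MeasurableSet {x : ℝ | ⌊x⌋ ∈ P} :=
  Int.measurable_floor (MeasurableSpace.measurableSet_top : MeasurableSet P)

/-- `p` is measurable. [folklore] -/
theorem measurable_ascSlot (R : ℕ) : Measurable (ascSlot Y R) := by
  refine Measurable.ite ?_ measurable_const measurable_const
  exact measurableSet_floor_mem {k | k ∈ (Finset.range R).image (upPos Y) ∨ (R : ℤ) ≤ k}

/-- `q` is measurable. [folklore] -/
theorem measurable_descSlot (R : ℕ) : Measurable (descSlot Y R) := by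
  refine Measurable.ite ?_ measurable_const measurable_const
  exact measurableSet_floor_mem {k | k ∈ (Finset.range R).image (downPos Y) ∨ k < -(R : ℤ)}

/-- `|p| ≤ 1`. [folklore] -/
theorem abs_ascSlot_le (R : ℕ) (x : ℝ) : |ascSlot Y R x| ≤ 1 := by
  unfold ascSlot; split_ifs <;> simp

/-- `|q| ≤ 1`. [folklore] -/
theorem abs_descSlot_le (R : ℕ) (x : ℝ) : |descSlot Y R x| ≤ 1 := by
  unfold descSlot; split_ifs <;> simp

/-- `0 ≤ p`. [folklore] -/
theorem ascSlot_nonneg (R : ℕ) (x : ℝ) : 0 ≤ ascSlot Y R x := by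
  unfold ascSlot; split_ifs <;> simp

/-- `p ≤ 1`. [folklore] -/
theorem ascSlot_le_one (R : ℕ) (x : ℝ) : ascSlot Y R x ≤ 1 := by
  unfold ascSlot; split_ifs <;> simp

/-- Values of the ascent positions in the window lie in `[-R, R)`. [folklore] -/
theorem mem_Ico_of_mem_image_upPos {R : ℕ} (hR₂ : Y.colLen 0 ≤ R) {k : ℤ}
    (hk : k ∈ (Finset.range R).image (upPos Y)) : -(R : ℤ) ≤ k ∧ k < R := by
  obtain ⟨j, hj, rfl⟩ := Finset.mem_image.mp hk
  have h1 := upPos_le Y j; have h2 := neg_le_upPos Y j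
  have hj' := Finset.mem_range.mp hj
  constructor <;> omega

/-- Values of the descent positions in the window lie in `[-R, R)`. [folklore] -/
theorem mem_Ico_of_mem_image_downPos {R : ℕ} (hR₁ : Y.rowLen 0 ≤ R) {k : ℤ}
    (hk : k ∈ (Finset.range R).image (downPos Y)) : -(R : ℤ) ≤ k ∧ k < R := by
  obtain ⟨i, hi, rfl⟩ := Finset.mem_image.mp hk
  have h1 := downPos_le Y i; have h2 := neg_le_downPos Y i
  have hi' := Finset.mem_range.mp hi
  constructor <;> omega

/-- **`p + q = 1`**: every unit slot is ascending or descending, never both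
(`{d_i} ⊔ {a_j} = ℤ`). [folklore] -/
theorem ascSlot_add_descSlot {R : ℕ} (hR₁ : Y.rowLen 0 ≤ R) (hR₂ : Y.colLen 0 ≤ R) (x : ℝ) :
    ascSlot Y R x + descSlot Y R x = 1 := by
  set k : ℤ := ⌊x⌋
  unfold ascSlot descSlot
  by_cases hA : ⌊x⌋ ∈ (Finset.range R).image (upPos Y)
  · have hb := mem_Ico_of_mem_image_upPos hR₂ hA
    have hD : ⌊x⌋ ∉ (Finset.range R).image (downPos Y) := by
      intro hD
      obtain ⟨j, -, hj⟩ := Finset.mem_image.mp hA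
      obtain ⟨i, -, hi⟩ := Finset.mem_image.mp hD
      exact upPos_ne_downPos Y i j (hj.trans hi.symm)
    rw [if_pos (Or.inl hA), if_neg (by push Not; exact ⟨hD, hb.1⟩)]; ring
  by_cases hD : ⌊x⌋ ∈ (Finset.range R).image (downPos Y)
  · have hb := mem_Ico_of_mem_image_downPos hR₁ hD
    rw [if_neg (by push Not; exact ⟨hA, hb.2⟩), if_pos (Or.inl hD)]; ring
  by_cases h1 : (R : ℤ) ≤ ⌊x⌋
  · rw [if_pos (Or.inr h1), if_neg (by push Not; exact ⟨hD, by omega⟩)]; ring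
  by_cases h2 : ⌊x⌋ < -(R : ℤ)
  · rw [if_neg (by push Not; exact ⟨hA, by omega⟩), if_pos (Or.inr h2)]; ring
  · -- `⌊x⌋ ∈ [-R, R)`: covered
    exfalso
    have hk : ⌊x⌋ ∈ Finset.Ico (-(R : ℤ)) R := Finset.mem_Ico.mpr ⟨by omega, by omega⟩
    rcases exists_downPos_or_upPos Y hR₁ hR₂ hk with ⟨i, hi, hik⟩ | ⟨j, hj, hjk⟩
    · exact hD (Finset.mem_image.mpr ⟨i, Finset.mem_range.mpr hi, hik⟩)
    · exact hA (Finset.mem_image.mpr ⟨j, Finset.mem_range.mpr hj, hjk⟩)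

/-- `p = 1` on `[R, ∞)`. [folklore] -/
theorem ascSlot_of_le {R : ℕ} {x : ℝ} (hx : (R : ℝ) ≤ x) : ascSlot Y R x = 1 := by
  unfold ascSlot
  rw [if_pos (Or.inr (Int.le_floor.mpr (by exact_mod_cast hx)))]

/-- `p = 0` on `(-∞, -R)`. [folklore] -/
theorem ascSlot_of_lt_neg {R : ℕ} (hR₂ : Y.colLen 0 ≤ R) {x : ℝ} (hx : x < -(R : ℝ)) :
    ascSlot Y R x = 0 := by
  unfold ascSlot
  have hfl : ⌊x⌋ < -(R : ℤ) := Int.floor_lt.mpr (by exact_mod_cast hx)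
  rw [if_neg]
  push Not
  exact ⟨fun h => by have := (mem_Ico_of_mem_image_upPos hR₂ h).1; omega, by omega⟩

/-- `p` is constant on unit slots: `p(x) = p(⌊x⌋)`. [folklore] -/
theorem ascSlot_eq_floor (R : ℕ) (x : ℝ) : ascSlot Y R x = ascSlot Y R (⌊x⌋ : ℝ) := by
  simp only [ascSlot, Int.floor_intCast]

/-- Sum of an indicator over an injective image. [folklore] -/
theorem ite_mem_image_eq_sum {ι : Type*} (s : Finset ι) {f : ι → ℤ} (hf : Function.Injective f) (k : ℤ) :
    (if k ∈ s.image f then (1:ℝ) else 0) = ∑ j ∈ s, if k = f j then (1:ℝ) else 0 := by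
  classical
  by_cases hk : k ∈ s.image f
  · rw [if_pos hk]
    obtain ⟨j₀, hj₀, rfl⟩ := Finset.mem_image.mp hk
    rw [Finset.sum_eq_single_of_mem j₀ hj₀ fun j _ hj => if_neg fun h => hj (hf h.symm)]
    simp
  · rw [if_neg hk]
    refine (Finset.sum_eq_zero fun j hj => if_neg fun h => hk ?_).symm
    exact Finset.mem_image.mpr ⟨j, hj, h.symm⟩

/-- Pointwise expansion of `T(x,y) p(x) q(y)` over pairs (ascent slot, descent slot).
[folklore] -/
theorem upperLogKernel_mul_ascSlot_mul_descSlot {R : ℕ} (hR₁ : Y.rowLen 0 ≤ R) (hR₂ : Y.colLen 0 ≤ R)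
    (p : ℝ × ℝ) :
    upperLogKernel p * ascSlot Y R p.1 * descSlot Y R p.2 =
      ∑ j ∈ Finset.range R, ∑ i ∈ Finset.range R, upperLogKernel p *
        (if ⌊p.1⌋ = upPos Y j then (1:ℝ) else 0) * (if ⌊p.2⌋ = downPos Y i then (1:ℝ) else 0) := by
  by_cases hlt : p.1 < p.2
  · have hfl : ⌊p.1⌋ ≤ ⌊p.2⌋ := Int.floor_mono hlt.le
    have key : ascSlot Y R p.1 * descSlot Y R p.2 =
        (if ⌊p.1⌋ ∈ (Finset.range R).image (upPos Y) then (1:ℝ) else 0) *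
          (if ⌊p.2⌋ ∈ (Finset.range R).image (downPos Y) then (1:ℝ) else 0) := by
      unfold ascSlot descSlot
      by_cases h1 : (R : ℤ) ≤ ⌊p.1⌋
      · have hD : ⌊p.2⌋ ∉ (Finset.range R).image (downPos Y) := fun h => by
          have := (mem_Ico_of_mem_image_downPos hR₁ h).2; omega
        have hA : ⌊p.1⌋ ∉ (Finset.range R).image (upPos Y) := fun h => by
          have := (mem_Ico_of_mem_image_upPos hR₂ h).2; omega
        rw [if_pos (Or.inr h1), if_neg (by push Not; exact ⟨hD, by omega⟩), if_neg hA]; ring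
      by_cases h2 : ⌊p.2⌋ < -(R : ℤ)
      · have hA : ⌊p.1⌋ ∉ (Finset.range R).image (upPos Y) := fun h => by
          have := (mem_Ico_of_mem_image_upPos hR₂ h).1; omega
        have hD : ⌊p.2⌋ ∉ (Finset.range R).image (downPos Y) := fun h => by
          have := (mem_Ico_of_mem_image_downPos hR₁ h).1; omega
        rw [if_neg (by push Not; exact ⟨hA, not_le.mp h1⟩), if_pos (Or.inr h2), if_neg hD]; ring
      · simp only [h1, h2, or_false]
    rw [mul_assoc, key, ite_mem_image_eq_sum _ (upPos_strictMono Y).injective,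
      ite_mem_image_eq_sum _ (downPos_strictAnti Y).injective, Finset.sum_mul_sum, Finset.mul_sum]
    refine Finset.sum_congr rfl fun j _ => ?_
    rw [Finset.mul_sum]
    refine Finset.sum_congr rfl fun i _ => ?_
    ring
  · simp [upperLogKernel_of_not_lt hlt]

/-! ### The hook form of one pair of slots -/

/-- `⌊x⌋ = e ↔ x ∈ [e, e+1)`. [folklore] -/
theorem floor_eq_iff_mem_Ico (x : ℝ) (e : ℤ) : ⌊x⌋ = e ↔ x ∈ Ico (e : ℝ) (e + 1) := by
  rw [Int.floor_eq_iff, mem_Ico]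

/-- Integrability of `T(x,y) 1{⌊x⌋ = e} 1{⌊y⌋ = d}`. [folklore] -/
theorem integrable_upperLogKernel_slot_slot (e d : ℤ) :
    Integrable fun p : ℝ × ℝ => upperLogKernel p *
      (if ⌊p.1⌋ = e then (1:ℝ) else 0) * (if ⌊p.2⌋ = d then (1:ℝ) else 0) := by
  set L : ℝ := max (|(e : ℝ)| + 1) (|(d : ℝ)| + 1) with hL
  refine integrable_upperLogKernel_mul_mul (C := 1) (L := L)
    (Measurable.ite (measurableSet_floor_mem {e}) measurable_const measurable_const)
    (Measurable.ite (measurableSet_floor_mem {d}) measurable_const measurable_const)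
    (fun x => by split_ifs <;> simp) (fun y => by split_ifs <;> simp) (fun x hx => ?_) (fun y hy => ?_)
    (by positivity)
  · rw [if_neg]
    intro h
    have h1 := ((floor_eq_iff_mem_Ico x e).mp h).1
    have : -L ≤ (e : ℝ) := by
      have := neg_abs_le (e : ℝ); have := le_max_left (|(e : ℝ)| + 1) (|(d : ℝ)| + 1); linarith
    linarith
  · rw [if_neg]
    intro h
    have h1 := ((floor_eq_iff_mem_Ico y d).mp h).2
    have : (d : ℝ) + 1 ≤ L := by
      have := le_abs_self (d : ℝ); have := le_max_right (|(e : ℝ)| + 1) (|(d : ℝ)| + 1); linarith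
    linarith

/-- **The hook form of a pair of unit slots**: for integers `e ≠ d`,
`∬ T(x,y) 1{⌊x⌋ = e} 1{⌊y⌋ = d} dx dy = K(d - e)` if `e < d` (the Vershik–Kerov cell kernel
`K(h) = ∫₀¹∫₀¹ log (h + t - s) dt ds`, `vkHookKernel`), and `= 0` if `d < e` (the slots are then in
the wrong order for the wedge `x < y`). [cite: VershikKerov1985, Lemma 1] -/
theorem hookForm_slot_slot {e d : ℤ} (hed : e ≠ d) :
    ∫ p : ℝ × ℝ, upperLogKernel p * (if ⌊p.1⌋ = e then (1:ℝ) else 0) * (if ⌊p.2⌋ = d then (1:ℝ) else 0) =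
      if e < d then vkHookKernel ((d : ℝ) - e) else 0 := by
  rcases lt_or_gt_of_ne hed with h | h
  · rw [if_pos h]
    have hed' : (e : ℝ) + 1 ≤ d := by exact_mod_cast Int.add_one_le_iff.mpr h
    set A : Set ℝ := Ico (e : ℝ) (e + 1) with hA
    set B : Set ℝ := Ico (d : ℝ) (d + 1) with hB
    have hpt : (fun p : ℝ × ℝ => upperLogKernel p * (if ⌊p.1⌋ = e then (1:ℝ) else 0) *
        (if ⌊p.2⌋ = d then (1:ℝ) else 0)) = (A ×ˢ B).indicator fun p => Real.log (p.2 - p.1) := by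
      ext ⟨x, y⟩
      simp only [indicator_apply, mem_prod]
      by_cases hx : ⌊x⌋ = e
      · by_cases hy : ⌊y⌋ = d
        · have hx' := (floor_eq_iff_mem_Ico x e).mp hx
          have hy' := (floor_eq_iff_mem_Ico y d).mp hy
          have hxy : x < y := by have := hx'.2; have := hy'.1; linarith
          rw [if_pos hx, if_pos hy, if_pos ⟨hx', hy'⟩]
          simp [upperLogKernel, hxy]
        · have hy' : y ∉ B := fun h' => hy ((floor_eq_iff_mem_Ico y d).mpr h')
          rw [if_neg hy, if_neg (show ¬(x ∈ A ∧ y ∈ B) from fun h => hy' h.2)]; ring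
      · have hx' : x ∉ A := fun h' => hx ((floor_eq_iff_mem_Ico x e).mpr h')
        rw [if_neg hx, if_neg (show ¬(x ∈ A ∧ y ∈ B) from fun h => hx' h.1)]; ring
    have hint : Integrable ((A ×ˢ B).indicator fun p : ℝ × ℝ => Real.log (p.2 - p.1)) := by
      rw [← hpt]; exact integrable_upperLogKernel_slot_slot e d
    rw [hpt, MeasureTheory.integral_indicator (measurableSet_Ico.prod measurableSet_Ico)]
    rw [integrable_indicator_iff (measurableSet_Ico.prod measurableSet_Ico)] at hint
    rw [IntegrableOn, Measure.volume_eq_prod, ← Measure.prod_restrict] at hint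
    rw [Measure.volume_eq_prod, ← Measure.prod_restrict, integral_prod _ hint]
    -- iterated interval integrals
    have hinner : ∀ x, ∫ y in B, Real.log (y - x) = ∫ t in (0:ℝ)..1, Real.log ((d : ℝ) + t - x) := by
      intro x
      have h3 := intervalIntegral.integral_comp_add_left (fun y => Real.log (y - x)) (d : ℝ) (a := 0) (b := 1)
      simp only [add_zero] at h3
      rw [hB, integral_Ico_eq_integral_Ioo, ← integral_Ioc_eq_integral_Ioo, ← integral_of_le (by linarith), ← h3]
    have h2 : ∫ x in A, ∫ y in B, Real.log (y - x) =
        ∫ s in (0:ℝ)..1, ∫ t in (0:ℝ)..1, Real.log ((d : ℝ) + t - ((e : ℝ) + s)) := by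
      simp_rw [hinner]
      have h3 := intervalIntegral.integral_comp_add_left
        (fun x => ∫ t in (0:ℝ)..1, Real.log ((d : ℝ) + t - x)) (e : ℝ) (a := 0) (b := 1)
      simp only [add_zero] at h3
      rw [hA, integral_Ico_eq_integral_Ioo, ← integral_Ioc_eq_integral_Ioo, ← integral_of_le (by linarith), ← h3]
    rw [h2, vkHookKernel]
    refine integral_congr fun s _ => integral_congr fun t _ => ?_
    ring_nf
  · rw [if_neg (not_lt.mpr h.le)]
    have hde' : (d : ℝ) + 1 ≤ e := by exact_mod_cast Int.add_one_le_iff.mpr h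
    refine integral_eq_zero_of_ae (Eventually.of_forall fun p => ?_)
    simp only [Pi.zero_apply]
    by_cases h1 : ⌊p.1⌋ = e
    · by_cases h2 : ⌊p.2⌋ = d
      · have hx := ((floor_eq_iff_mem_Ico p.1 e).mp h1).1
        have hy := ((floor_eq_iff_mem_Ico p.2 d).mp h2).2
        rw [upperLogKernel_of_not_lt (by push Not; linarith)]; ring
      · simp [h2]
    · simp [h1]

/-! ### The cell sum as a hook form -/

/-- Cells lie in the window `[0, R)²` when `R ≥ λ_0, λ'_0`. [folklore] -/
theorem cells_eq_filter_range {R : ℕ} (hR₁ : Y.rowLen 0 ≤ R) (hR₂ : Y.colLen 0 ≤ R) :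
    Y.cells = (Finset.range R ×ˢ Finset.range R).filter (· ∈ Y) := by
  ext ⟨i, j⟩
  simp only [YoungDiagram.mem_cells, Finset.mem_filter, Finset.mem_product, Finset.mem_range]
  constructor
  · intro h
    have h₁ : j < Y.rowLen i := YoungDiagram.mem_iff_lt_rowLen.mp h
    have h₂ : i < Y.colLen j := YoungDiagram.mem_iff_lt_colLen.mp h
    have h₃ := Y.rowLen_anti 0 i (Nat.zero_le i)
    have h₄ := Y.colLen_anti 0 j (Nat.zero_le j)
    exact ⟨⟨by omega, by omega⟩, h⟩
  · exact fun h => h.2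

/-- **The Vershik–Kerov cell sum is the hook form of the boundary slopes**:
`∑_{c ∈ λ} K(h(c)) = ∬_{x<y} log (y-x) p(x) q(y) dx dy` with `p, q` the ascending/descending slot
indicators (each cell `(i,j)` is the pair (ascent slot `a_j`, descent slot `d_i`) with `a_j < d_i`
and `h = d_i - a_j`; pairs in the wrong order contribute `0`). This is Vershik–Kerov's Lemma 1 in the
form `∑_c K(h_c) = ¼ ∬_{x<y} log (y-x) (1 + f'(x))(1 - f'(y))`. [cite: VershikKerov1985, Lemma 1] -/
theorem sum_vkHookKernel_eq_hookForm {R : ℕ} (hR₁ : Y.rowLen 0 ≤ R) (hR₂ : Y.colLen 0 ≤ R) :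
    ∑ c ∈ Y.cells, vkHookKernel (hookLength Y c) =
      ∫ p : ℝ × ℝ, upperLogKernel p * ascSlot Y R p.1 * descSlot Y R p.2 := by
  simp_rw [upperLogKernel_mul_ascSlot_mul_descSlot hR₁ hR₂]
  rw [integral_finsetSum _ fun j _ => integrable_finsetSum _ fun i _ =>
    integrable_upperLogKernel_slot_slot _ _]
  simp_rw [integral_finsetSum _ fun i _ => integrable_upperLogKernel_slot_slot _ _]
  simp_rw [hookForm_slot_slot (upPos_ne_downPos Y _ _)]
  rw [cells_eq_filter_range hR₁ hR₂, Finset.sum_filter, Finset.sum_product, Finset.sum_comm]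
  refine Finset.sum_congr rfl fun j _ => Finset.sum_congr rfl fun i _ => ?_
  simp only [mem_iff_upPos_lt_downPos Y]
  split_ifs with h
  · congr 1
    have h2 := hookLength_eq_downPos_sub_upPos Y ((mem_iff_upPos_lt_downPos Y).mpr h)
    have h3 : (hookLength Y (i, j) : ℝ) = ((hookLength Y (i, j) : ℤ) : ℝ) := by push_cast; ring
    rw [h3, h2]
    push_cast
    ring
  · rfl

/-! ### Row/column sums and the two moments of the ascending-slot indicator -/

/-- **`∑_{j<R} λ'_j = |λ|`** for `R ≥ λ_0` (number of columns). [folklore] -/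
theorem sum_colLen_eq_card {R : ℕ} (hR₁ : Y.rowLen 0 ≤ R) :
    ∑ j ∈ Finset.range R, Y.colLen j = Y.cells.card := by
  have h := sum_rowLen_eq_card Y.transpose (M := R) (by rwa [YoungDiagram.colLen_transpose])
  simp only [YoungDiagram.rowLen_transpose, YoungDiagram.card_transpose] at h
  exact h

/-- On the window `[-R, R)` the ascending-slot indicator is the sum of the slot indicators of the
`a_j`, `j < R`; outside it that sum vanishes. [folklore] -/
theorem indicator_ascSlot_eq_sum {R : ℕ} (hR₂ : Y.colLen 0 ≤ R) (x : ℝ) :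
    (Ico (-(R : ℝ)) R).indicator (ascSlot Y R) x =
      ∑ j ∈ Finset.range R, if ⌊x⌋ = upPos Y j then (1:ℝ) else 0 := by
  rw [← ite_mem_image_eq_sum _ (upPos_strictMono Y).injective]
  by_cases hx : x ∈ Ico (-(R : ℝ)) R
  · rw [indicator_of_mem hx, ascSlot]
    have h1 : ⌊x⌋ < R := Int.floor_lt.mpr (by exact_mod_cast hx.2)
    have h2 : ¬ (R : ℤ) ≤ ⌊x⌋ := not_le.mpr h1
    simp only [h2, or_false]
  · rw [indicator_of_notMem hx, if_neg]
    intro hA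
    have hb := mem_Ico_of_mem_image_upPos hR₂ hA
    apply hx
    rw [mem_Ico]
    constructor
    · have : (-(R : ℤ) : ℝ) ≤ (⌊x⌋ : ℝ) := by exact_mod_cast hb.1
      push_cast at this
      linarith [Int.floor_le x]
    · have : (⌊x⌋ : ℝ) + 1 ≤ R := by exact_mod_cast Int.add_one_le_iff.mpr hb.2
      linarith [Int.lt_floor_add_one x]

/-- `∫ 1{⌊x⌋ = e} g(x) dx = ∫_e^{e+1} g` for continuous `g`. [folklore] -/
theorem integral_ite_floor_eq_mul (e : ℤ) (g : ℝ → ℝ) :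
    ∫ x, (if ⌊x⌋ = e then (1:ℝ) else 0) * g x = ∫ x in (e : ℝ)..(e + 1), g x := by
  have h : (fun x => (if ⌊x⌋ = e then (1:ℝ) else 0) * g x) = (Ico (e : ℝ) (e + 1)).indicator g := by
    ext x
    simp only [indicator_apply, ← floor_eq_iff_mem_Ico]
    split_ifs <;> simp
  rw [h, MeasureTheory.integral_indicator measurableSet_Ico, integral_Ico_eq_integral_Ioo,
    ← integral_Ioc_eq_integral_Ioo, ← integral_of_le (by linarith)]

/-- Integrability of `1{⌊x⌋ = e} g(x)` for continuous `g`. [folklore] -/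
theorem integrable_ite_floor_eq_mul (e : ℤ) {g : ℝ → ℝ} (hg : Continuous g) :
    Integrable fun x => (if ⌊x⌋ = e then (1:ℝ) else 0) * g x := by
  have h : (fun x => (if ⌊x⌋ = e then (1:ℝ) else 0) * g x) = (Ico (e : ℝ) (e + 1)).indicator g := by
    ext x
    simp only [indicator_apply, ← floor_eq_iff_mem_Ico]
    split_ifs <;> simp
  rw [h, integrable_indicator_iff measurableSet_Ico]
  exact (hg.continuousOn.integrableOn_compact isCompact_Icc).mono_set Ico_subset_Icc_self

/-- `∫_{-R}^{R} p(x) g(x) dx = ∑_{j<R} ∫_{a_j}^{a_j+1} g` for continuous `g`. [folklore] -/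
theorem integral_ascSlot_mul {R : ℕ} (hR₂ : Y.colLen 0 ≤ R) {g : ℝ → ℝ} (hg : Continuous g) :
    ∫ x in (-(R : ℝ))..R, ascSlot Y R x * g x =
      ∑ j ∈ Finset.range R, ∫ x in (upPos Y j : ℝ)..(upPos Y j + 1), g x := by
  have hR : (-(R : ℝ)) ≤ R := by have : (0:ℝ) ≤ R := Nat.cast_nonneg R; linarith
  rw [integral_of_le hR, ← integral_Icc_eq_integral_Ioc, integral_Icc_eq_integral_Ico,
    ← MeasureTheory.integral_indicator measurableSet_Ico]
  have h : ∀ x, (Ico (-(R : ℝ)) R).indicator (fun x => ascSlot Y R x * g x) x =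
      ∑ j ∈ Finset.range R, (if ⌊x⌋ = upPos Y j then (1:ℝ) else 0) * g x := by
    intro x
    rw [← Finset.sum_mul, ← indicator_ascSlot_eq_sum hR₂ x]
    simp only [indicator_apply]
    split_ifs <;> simp
  simp_rw [h]
  rw [integral_finsetSum _ fun j _ => integrable_ite_floor_eq_mul _ hg]
  exact Finset.sum_congr rfl fun j _ => integral_ite_floor_eq_mul _ g

/-- **Charge count**: `∫_{-R}^{R} p = R` (there are `R` ascending slots in the window).
[folklore] -/
theorem integral_ascSlot {R : ℕ} (hR₂ : Y.colLen 0 ≤ R) :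
    ∫ x in (-(R : ℝ))..R, ascSlot Y R x = R := by
  have h := integral_ascSlot_mul hR₂ (g := fun _ => (1:ℝ)) continuous_const
  simp only [mul_one, intervalIntegral.integral_const, smul_eq_mul, add_sub_cancel_left,
    Finset.sum_const, Finset.card_range, nsmul_eq_mul] at h
  exact h

/-- **Area count**: `∫_{-R}^{R} x p(x) dx = R²/2 - |λ|` (equivalently, the area between the rotated
boundary and `|x|` is `2|λ|`). [folklore] -/
theorem integral_id_mul_ascSlot {R : ℕ} (hR₁ : Y.rowLen 0 ≤ R) (hR₂ : Y.colLen 0 ≤ R) :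
    ∫ x in (-(R : ℝ))..R, x * ascSlot Y R x = (R : ℝ) ^ 2 / 2 - Y.cells.card := by
  have h := integral_ascSlot_mul hR₂ (g := fun x => x) continuous_id
  simp only [integral_id] at h
  have h2 : ∀ j, (((upPos Y j : ℝ) + 1) ^ 2 - (upPos Y j : ℝ) ^ 2) / 2 =
      ((j : ℝ) + 1 / 2) - Y.colLen j := by
    intro j; simp only [upPos]; push_cast; ring
  simp_rw [h2] at h
  rw [Finset.sum_sub_distrib, sum_range_add_half] at h
  rw [show (fun x => x * ascSlot Y R x) = fun x => ascSlot Y R x * x from funext fun x => mul_comm _ _, h,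
    ← sum_colLen_eq_card (Y := Y) hR₁]
  push_cast
  ring

/-! ### The hook form: symmetrisation of the quadratic term and the expansion around `F_a` -/

/-- **`𝔅(η, η) = ½ ∬ η(x) η(y) log |x - y|`** for a bounded measurable `η` vanishing off `[-L, L]`
(swap the variables: `T(x,y) + T(y,x) = log |x - y|` off the diagonal). [folklore] -/
theorem hookForm_self_eq_half_logEnergy {η : ℝ → ℝ} {C L : ℝ} (hηm : Measurable η)
    (hηC : ∀ x, |η x| ≤ C) (hη0 : ∀ x ∉ Icc (-L) L, η x = 0) (hL : 0 ≤ L) :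
    ∫ p : ℝ × ℝ, upperLogKernel p * η p.1 * η p.2 =
      (1 / 2) * ∫ p : ℝ × ℝ, η p.1 * η p.2 * Real.log |p.1 - p.2| := by
  have hint1 : Integrable fun p : ℝ × ℝ => upperLogKernel p * η p.1 * η p.2 :=
    integrable_upperLogKernel_mul_mul hηm hηm hηC hηC (fun x hx => hη0 x fun h => by linarith [h.1])
      (fun y hy => hη0 y fun h => by linarith [h.2]) hL
  have hswap : ∫ p : ℝ × ℝ, upperLogKernel p * η p.1 * η p.2 =
      ∫ p : ℝ × ℝ, upperLogKernel p.swap * η p.2 * η p.1 := by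
    rw [Measure.volume_eq_prod, ← integral_prod_swap]
    rfl
  have hint2 : Integrable fun p : ℝ × ℝ => upperLogKernel p.swap * η p.2 * η p.1 := by
    have h := (integrable_swap_iff (μ := (volume : Measure ℝ)) (ν := (volume : Measure ℝ))
      (f := fun p : ℝ × ℝ => upperLogKernel p * η p.1 * η p.2)).mpr
      (by rw [← Measure.volume_eq_prod]; exact hint1)
    rw [← Measure.volume_eq_prod] at h
    exact h
  have hlog : Integrable fun p : ℝ × ℝ => η p.1 * η p.2 * Real.log |p.1 - p.2| := by
    have h := integrable_mul_mul_kernel (κ := fun t => Real.log |t|) hηm hηm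
      (Real.measurable_log.comp continuous_abs.measurable) hηC hηC hη0 hη0
      (integrableOn_Icc_of_intervalIntegrable (by linarith) (by
        simp_rw [Real.log_abs]; exact intervalIntegrable_log'))
    rw [Measure.volume_eq_prod]; exact h
  have h2 : 2 * ∫ p : ℝ × ℝ, upperLogKernel p * η p.1 * η p.2 =
      ∫ p : ℝ × ℝ, η p.1 * η p.2 * Real.log |p.1 - p.2| := by
    rw [two_mul]
    nth_rewrite 2 [hswap]
    rw [← MeasureTheory.integral_add hint1 hint2]
    refine integral_congr_ae ?_
    filter_upwards [ae_fst_ne_snd] with p hp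
    simp only [upperLogKernel, Prod.fst_swap, Prod.snd_swap]
    rcases lt_or_gt_of_ne hp with h | h
    · rw [if_pos h, if_neg (not_lt.mpr h.le), abs_of_neg (sub_neg.mpr h), neg_sub]; ring
    · rw [if_neg (not_lt.mpr h.le), if_pos h, abs_of_pos (sub_pos.mpr h)]; ring
  linarith

/-- Integrability of `T F_a(x) (1 - F_a(y))`. [folklore] -/
theorem integrable_upperLogKernel_arcsine {a : ℝ} (ha : 0 < a) :
    Integrable fun p : ℝ × ℝ => upperLogKernel p * arcsineCDF a p.1 * (1 - arcsineCDF a p.2) := by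
  set φ : ℝ → ℝ := fun x => if x ≤ a then arcsineCDF a x else 0 with hφ
  have hpt : (fun p : ℝ × ℝ => upperLogKernel p * arcsineCDF a p.1 * (1 - arcsineCDF a p.2)) =
      fun p => upperLogKernel p * φ p.1 * (1 - arcsineCDF a p.2) := by
    ext ⟨x, y⟩
    simp only [hφ]
    by_cases hx : x ≤ a
    · rw [if_pos hx]
    · rw [if_neg hx]
      by_cases hxy : x < y
      · rw [arcsineCDF_of_le ha (by linarith : a ≤ y)]; ring
      · rw [upperLogKernel_of_not_lt (by exact hxy)]; ring
  rw [hpt]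
  refine integrable_upperLogKernel_mul_mul (C := 1) (L := a) (χ := fun y => 1 - arcsineCDF a y)
    (Measurable.ite measurableSet_Iic (continuous_arcsineCDF a).measurable measurable_const)
    (measurable_const.sub (continuous_arcsineCDF a).measurable) (fun x => ?_) (fun y => ?_)
    (fun x hx => ?_) (fun y hy => ?_) ha.le
  · show |(if x ≤ a then arcsineCDF a x else 0)| ≤ 1
    split_ifs
    · rw [abs_of_nonneg (arcsineCDF_nonneg a x)]; exact arcsineCDF_le_one a x
    · simp
  · rw [abs_of_nonneg (sub_nonneg.mpr (arcsineCDF_le_one a y))]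
    linarith [arcsineCDF_nonneg a y]
  · show (if x ≤ a then arcsineCDF a x else 0) = 0
    rw [arcsineCDF_of_le_neg ha hx.le]; simp
  · show 1 - arcsineCDF a y = 0
    rw [arcsineCDF_of_le ha hy.le, sub_self]

/-- **Expansion of the hook form around the arcsine law.** For `a > 0` and a bounded measurable
`φ` with `η := φ - F_a` vanishing off `[-L, L]`, `L ≥ a`:
`𝔅(φ, 1 - φ) = 𝔅(F_a, 1 - F_a) + [𝔅(η, 1 - F_a) - 𝔅(F_a, η)] - 𝔅(η, η)`
(bilinearity; the four terms are integrable). This is the algebraic skeleton of Vershik–Kerov's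
expansion of the hook integral around the limit shape (Vershik–Kerov 1985, Lemmas 2–4).
[cite: VershikKerov1985, Lemma 2] -/
theorem hookForm_expand {φ η : ℝ → ℝ} {C L a : ℝ} (ha : 0 < a) (haL : a ≤ L)
    (hηm : Measurable η) (hηC : ∀ x, |η x| ≤ C)
    (hη0 : ∀ x ∉ Icc (-L) L, η x = 0) (hφη : ∀ x, φ x = arcsineCDF a x + η x) :
    ∫ p : ℝ × ℝ, upperLogKernel p * φ p.1 * (1 - φ p.2) =
      (∫ p : ℝ × ℝ, upperLogKernel p * arcsineCDF a p.1 * (1 - arcsineCDF a p.2)) +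
      ((∫ p : ℝ × ℝ, upperLogKernel p * η p.1 * (1 - arcsineCDF a p.2)) -
        ∫ p : ℝ × ℝ, upperLogKernel p * arcsineCDF a p.1 * η p.2) -
      ∫ p : ℝ × ℝ, upperLogKernel p * η p.1 * η p.2 := by
  have hL : 0 ≤ L := ha.le.trans haL
  have hC0 : 0 ≤ C := (abs_nonneg _).trans (hηC 0)
  set C' : ℝ := max C 1 with hC'
  have hηC' : ∀ x, |η x| ≤ C' := fun x => (hηC x).trans (le_max_left _ _)
  have hFm : Measurable (arcsineCDF a) := (continuous_arcsineCDF a).measurable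
  have hFC' : ∀ x, |arcsineCDF a x| ≤ C' := fun x => by
    rw [abs_of_nonneg (arcsineCDF_nonneg a x)]; exact (arcsineCDF_le_one a x).trans (le_max_right _ _)
  have h1FC' : ∀ y, |1 - arcsineCDF a y| ≤ C' := fun y => by
    rw [abs_of_nonneg (sub_nonneg.mpr (arcsineCDF_le_one a y))]
    linarith [arcsineCDF_nonneg a y, le_max_right C 1]
  have hη_lo : ∀ x, x < -L → η x = 0 := fun x hx => hη0 x fun h => by linarith [h.1]
  have hη_hi : ∀ y, L < y → η y = 0 := fun y hy => hη0 y fun h => by linarith [h.2]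
  have i1 := integrable_upperLogKernel_arcsine ha
  have i2 : Integrable fun p : ℝ × ℝ => upperLogKernel p * η p.1 * (1 - arcsineCDF a p.2) :=
    integrable_upperLogKernel_mul_mul (χ := fun y => 1 - arcsineCDF a y) hηm (measurable_const.sub hFm)
      hηC' h1FC' hη_lo (fun y hy => by
        show 1 - arcsineCDF a y = 0
        rw [arcsineCDF_of_le ha (haL.trans hy.le), sub_self]) hL
  have i3 : Integrable fun p : ℝ × ℝ => upperLogKernel p * arcsineCDF a p.1 * η p.2 :=
    integrable_upperLogKernel_mul_mul hFm hηm hFC' hηC'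
      (fun x hx => arcsineCDF_of_le_neg ha (by linarith)) hη_hi hL
  have i4 : Integrable fun p : ℝ × ℝ => upperLogKernel p * η p.1 * η p.2 :=
    integrable_upperLogKernel_mul_mul hηm hηm hηC' hηC' hη_lo hη_hi hL
  have hpt : ∀ p : ℝ × ℝ, upperLogKernel p * φ p.1 * (1 - φ p.2) =
      upperLogKernel p * arcsineCDF a p.1 * (1 - arcsineCDF a p.2) +
        (upperLogKernel p * η p.1 * (1 - arcsineCDF a p.2) -
          upperLogKernel p * arcsineCDF a p.1 * η p.2) -
        upperLogKernel p * η p.1 * η p.2 := by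
    intro p; rw [hφη p.1, hφη p.2]; ring
  simp_rw [hpt]
  have i23 : Integrable fun p : ℝ × ℝ => upperLogKernel p * η p.1 * (1 - arcsineCDF a p.2) -
      upperLogKernel p * arcsineCDF a p.1 * η p.2 := i2.sub i3
  have i123 : Integrable fun p : ℝ × ℝ => upperLogKernel p * arcsineCDF a p.1 * (1 - arcsineCDF a p.2) +
      (upperLogKernel p * η p.1 * (1 - arcsineCDF a p.2) - upperLogKernel p * arcsineCDF a p.1 * η p.2) :=
    i1.add i23
  rw [MeasureTheory.integral_sub i123 i4, MeasureTheory.integral_add i1 i23, MeasureTheory.integral_sub i2 i3]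

/-! ### `∫_0^1 u arcsin u du = π/8` and the first moment of `F_a` -/

/-- **`∫_0^1 u arcsin u du = π/8`** (antiderivative `(u²/2 - ¼) arcsin u + u √(1-u²)/4`).
[folklore] -/
theorem integral_id_mul_arcsin : ∫ u in (0:ℝ)..1, u * Real.arcsin u = π / 8 := by
  set G : ℝ → ℝ := fun u => (u ^ 2 / 2 - 1 / 4) * Real.arcsin u + u * Real.sqrt (1 - u ^ 2) / 4 with hG
  have hderiv : ∀ u ∈ Ioo (0:ℝ) 1, HasDerivAt G (u * Real.arcsin u) u := by
    intro u hu
    have hu1 : u ≠ -1 := by linarith [hu.1]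
    have hu2 : u ≠ 1 := hu.2.ne
    have hpos : 0 < 1 - u ^ 2 := by nlinarith [hu.1, hu.2]
    have hsq : Real.sqrt (1 - u ^ 2) ≠ 0 := (Real.sqrt_pos.mpr hpos).ne'
    have hsq2 : Real.sqrt (1 - u ^ 2) ^ 2 = 1 - u ^ 2 := Real.sq_sqrt hpos.le
    have hA : HasDerivAt Real.arcsin (1 / Real.sqrt (1 - u ^ 2)) u := Real.hasDerivAt_arcsin hu1 hu2
    have hQ : HasDerivAt (fun u : ℝ => 1 - u ^ 2) (-(2 * u)) u := by
      simpa using (hasDerivAt_pow 2 u).const_sub 1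
    have hS : HasDerivAt (fun u : ℝ => Real.sqrt (1 - u ^ 2)) (-(2 * u) / (2 * Real.sqrt (1 - u ^ 2))) u :=
      hQ.sqrt hpos.ne'
    have hP : HasDerivAt (fun u : ℝ => u ^ 2 / 2 - 1 / 4) (2 * u / 2) u := by
      simpa using ((hasDerivAt_pow 2 u).div_const 2).sub_const (1 / 4 : ℝ)
    have h := (hP.mul hA).add (((hasDerivAt_id u).mul hS).div_const 4)
    refine h.congr_deriv ?_
    simp only [id_eq]
    field_simp
    nlinarith [hsq2]
  have hcont : ContinuousOn G (Icc 0 1) := by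
    have : Continuous G := by rw [hG]; fun_prop
    exact this.continuousOn
  rw [intervalIntegral.integral_eq_sub_of_hasDerivAt_of_le zero_le_one hcont hderiv
    ((continuous_id.mul Real.continuous_arcsin).intervalIntegrable _ _)]
  simp only [hG, Real.arcsin_one, Real.arcsin_zero, one_pow, sub_self, Real.sqrt_zero]
  ring

/-- `∫_{-R}^{R} F_a = R` for `R ≥ 0` (`F_a(x) + F_a(-x) = 1`). [folklore] -/
theorem integral_arcsineCDF (a R : ℝ) :
    ∫ x in (-R)..R, arcsineCDF a x = R := by
  have hc : Continuous (arcsineCDF a) := continuous_arcsineCDF a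
  have h1 : ∫ x in (-R)..R, arcsineCDF a x = ∫ x in (-R)..R, arcsineCDF a (-x) := by
    rw [intervalIntegral.integral_comp_neg]; simp
  have hi : IntervalIntegrable (fun x => arcsineCDF a (-x)) volume (-R) R :=
    (hc.comp continuous_neg).intervalIntegrable _ _
  have h2 : (∫ x in (-R)..R, arcsineCDF a x) + ∫ x in (-R)..R, arcsineCDF a (-x) = 2 * R := by
    rw [← intervalIntegral.integral_add (hc.intervalIntegrable _ _) hi]
    simp_rw [arcsineCDF_neg]
    simp; ring
  linarith

/-- **First moment**: `∫_{-R}^{R} x F_a(x) dx = R²/2 - a²/4` for `R ≥ a > 0`. [folklore] -/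
theorem integral_id_mul_arcsineCDF {a R : ℝ} (ha : 0 < a) (hR : a ≤ R) :
    ∫ x in (-R)..R, x * arcsineCDF a x = R ^ 2 / 2 - a ^ 2 / 4 := by
  have hc : Continuous (arcsineCDF a) := continuous_arcsineCDF a
  -- even part
  set g : ℝ → ℝ := fun x => x * (arcsineCDF a x - 1 / 2) with hg
  have hgc : Continuous g := by rw [hg]; fun_prop
  have hgeven : ∀ x, g (-x) = g x := fun x => by simp only [hg, arcsineCDF_neg]; ring
  have hsplit : ∀ x, x * arcsineCDF a x = x / 2 + g x := fun x => by simp only [hg]; ring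
  simp_rw [hsplit]
  rw [intervalIntegral.integral_add (Continuous.intervalIntegrable (by fun_prop) _ _)
    (hgc.intervalIntegrable _ _)]
  have h0 : ∫ x in (-R)..R, x / 2 = 0 := by
    rw [intervalIntegral.integral_div, integral_id]; ring
  -- `∫_{-R}^{R} g = 2 ∫_0^R g`
  have h1 : ∫ x in (-R)..R, g x = 2 * ∫ x in (0:ℝ)..R, g x := by
    rw [← integral_add_adjacent_intervals (b := 0) (hgc.intervalIntegrable _ _)
      (hgc.intervalIntegrable _ _)]
    have h5 : ∫ x in (-R)..0, g x = ∫ x in (0:ℝ)..R, g x := by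
      have h6 := intervalIntegral.integral_comp_neg (a := (0:ℝ)) (b := R) g
      simp only [hgeven, neg_zero] at h6
      exact h6.symm
    rw [h5]; ring
  -- `∫_0^R g = ∫_0^a g + ∫_a^R x/2`
  have h2 : ∫ x in (0:ℝ)..R, g x = (∫ x in (0:ℝ)..a, g x) + ∫ x in a..R, x / 2 := by
    rw [← integral_add_adjacent_intervals (b := a) (hgc.intervalIntegrable _ _)
      (hgc.intervalIntegrable _ _)]
    congr 1
    refine integral_congr fun x hx => ?_
    rw [uIcc_of_le hR] at hx
    simp only [hg, arcsineCDF_of_le ha hx.1]; ring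
  have h3 : ∫ x in a..R, x / 2 = (R ^ 2 - a ^ 2) / 4 := by
    rw [intervalIntegral.integral_div, integral_id]; ring
  -- `∫_0^a g = a²/8`
  have h4 : ∫ x in (0:ℝ)..a, g x = a ^ 2 / 8 := by
    have hga : ∀ x, g x = (fun u => a * u * Real.arcsin u / π) (x / a) := by
      intro x; simp only [hg, arcsineCDF]; field_simp; ring
    rw [show (∫ x in (0:ℝ)..a, g x) = ∫ x in (0:ℝ)..a, (fun u => a * u * Real.arcsin u / π) (x / a) from
      integral_congr fun x _ => hga x]
    rw [intervalIntegral.integral_comp_div (fun u => a * u * Real.arcsin u / π) ha.ne', zero_div,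
      div_self ha.ne', smul_eq_mul]
    have : ∫ u in (0:ℝ)..1, a * u * Real.arcsin u / π = a / π * ∫ u in (0:ℝ)..1, u * Real.arcsin u := by
      rw [← intervalIntegral.integral_const_mul]
      exact integral_congr fun u _ => by ring
    rw [this, integral_id_mul_arcsin]
    field_simp
  rw [h0, h1, h2, h3, h4]
  ring

/-! ### Assembly: the Logan–Shepp–Vershik–Kerov inequality (LSVK) and the discharge -/

/-- Interval integrability of the ascending-slot indicator. [folklore] -/
theorem intervalIntegrable_ascSlot (R : ℕ) (b c : ℝ) : IntervalIntegrable (ascSlot Y R) volume b c :=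
  (intervalIntegrable_const (c := (1:ℝ))).mono_fun' (measurable_ascSlot R).aestronglyMeasurable
    (Eventually.of_forall fun x => by
      show ‖ascSlot Y R x‖ ≤ 1
      rw [Real.norm_eq_abs]; exact abs_ascSlot_le R x)

/-- The ascending-slot indicator takes the values `0, 1` only. [folklore] -/
theorem ascSlot_eq_zero_or_one (R : ℕ) (x : ℝ) : ascSlot Y R x = 0 ∨ ascSlot Y R x = 1 := by
  unfold ascSlot; split_ifs <;> simp

/-- `(1 - F_a(j+1))² = ¼ ψ((j+1)/a)` and the two slot minima at `±` positions. [folklore] -/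
theorem arcsineCDF_slot_sq {a : ℝ} (ha : 0 < a) (j : ℕ) :
    min (arcsineCDF a j) (1 - arcsineCDF a ((j : ℝ) + 1)) ^ 2 = vkPsi (((j : ℝ) + 1) / a) / 4 ∧
    min (arcsineCDF a (-(j : ℝ) - 1)) (1 - arcsineCDF a (-(j : ℝ) - 1 + 1)) ^ 2 =
      vkPsi (((j : ℝ) + 1) / a) / 4 := by
  have hπ := Real.pi_pos
  have hj0 : (0 : ℝ) ≤ j := Nat.cast_nonneg j
  have h1 : 1 / 2 ≤ arcsineCDF a j := by
    have : 0 ≤ Real.arcsin ((j : ℝ) / a) := Real.arcsin_nonneg.mpr (div_nonneg hj0 ha.le)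
    unfold arcsineCDF
    have := div_nonneg this hπ.le
    linarith
  have h2 : arcsineCDF a ((j : ℝ) + 1) ≥ 1 / 2 := by
    have : 0 ≤ Real.arcsin (((j : ℝ) + 1) / a) := Real.arcsin_nonneg.mpr (div_nonneg (by linarith) ha.le)
    unfold arcsineCDF
    have := div_nonneg this hπ.le
    linarith
  have hsq : (1 - arcsineCDF a ((j : ℝ) + 1)) ^ 2 = vkPsi (((j : ℝ) + 1) / a) / 4 := by
    unfold arcsineCDF vkPsi
    field_simp
    ring
  constructor
  · rw [min_eq_right (by linarith), hsq]
  · rw [show -(j : ℝ) - 1 + 1 = -(j : ℝ) by ring, show -(j : ℝ) - 1 = -((j : ℝ) + 1) by ring,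
      arcsineCDF_neg, arcsineCDF_neg, min_eq_left (by linarith), hsq]

/-- **The Logan–Shepp–Vershik–Kerov inequality (the hypothesis (LSVK) of
`VershikKerov1985_maxCharDegree_of_hookIntegral_bound`).** For `N ≥ 1` and every `μ ⊢ N`,
`½ (N log N - N) + S_N/16 ≤ J(μ) = ∑_{c ∈ μ} K(h(c))`.
Proof (Vershik–Kerov 1985, Lemmas 1–4 and §3, in the hook-form organisation of this development):
with `a = 2√N`, `p` the ascending-slot indicator of the rotated boundary of `μ` and
`η = p - F_a`, `J(μ) = 𝔅(p, 1-p)` (`sum_vkHookKernel_eq_hookForm`),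
`= 𝔅(F_a, 1-F_a) + [linear term] - 𝔅(η, η)` (`hookForm_expand`); the first is `½ (N log N - N)`
(`hookForm_arcsine`), the linear term is `≥ 0` (`integral_mul_arcsineLinPot_nonneg`, using
`∫ η = 0` — `R` ascending slots in `[-R, R)` — and `∫ x η = 0` — the area of `μ` is `N`), and
`-𝔅(η, η) = -½ ∬ ηη log|x-y| ≥ ½ ∫₀¹ s⁻² D(s) ds ≥ ¼ ∑_k n_k² = S_N/16` (`LogEnergyLayers`), where
on each unit slot `[k, k+1)`, `|k| < ⌊2√N⌋`, `η` keeps a sign with `|η| ≥ n_k = min(F_a(k), 1 - F_a(k+1))`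
and `n_k² = ¼ ψ(j/2√N)`. [cite: VershikKerov1985, Thm. 1 (as quoted in Pak–Panova–Yeliussizov 2019, arXiv:1804.04693, §2.3 eq. (2.3))] -/
theorem lsvk_inequality (N : ℕ) (hN : 1 ≤ N) (μ : Nat.Partition N) :
    ((N : ℝ) * Real.log N - N) / 2 + vkDiagSum N / 16 ≤ vkJCells μ := by
  have hπ := Real.pi_pos
  set Y := μ.youngDiagram with hY
  have hcard : Y.cells.card = N := μ.card_cells_youngDiagram
  set a : ℝ := 2 * Real.sqrt N with ha
  have hN0 : (0:ℝ) < N := by exact_mod_cast hN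
  have hsqrt : 0 < Real.sqrt N := Real.sqrt_pos.mpr hN0
  have ha0 : 0 < a := by positivity
  have hsq : Real.sqrt (N : ℝ) ^ 2 = N := Real.sq_sqrt hN0.le
  set R : ℕ := max (max (Y.rowLen 0) (Y.colLen 0)) ⌈a⌉₊ with hR
  have hR₁ : Y.rowLen 0 ≤ R := (le_max_left _ _).trans (le_max_left _ _)
  have hR₂ : Y.colLen 0 ≤ R := (le_max_right _ _).trans (le_max_left _ _)
  have haR : a ≤ R := (Nat.le_ceil a).trans (by exact_mod_cast le_max_right _ _)
  have hR0 : (0:ℝ) ≤ R := Nat.cast_nonneg R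
  set F : ℝ → ℝ := arcsineCDF a with hF
  set φ : ℝ → ℝ := ascSlot Y R with hφ
  set η : ℝ → ℝ := fun x => φ x - F x with hη
  -- properties of `η`
  have hηm : Measurable η := (measurable_ascSlot R).sub (continuous_arcsineCDF a).measurable
  have hηC : ∀ x, |η x| ≤ 1 := by
    intro x
    simp only [hη, hφ, hF]
    rw [abs_le]
    constructor <;> linarith [ascSlot_nonneg (Y := Y) R x, ascSlot_le_one (Y := Y) R x,
      arcsineCDF_nonneg a x, arcsineCDF_le_one a x]
  have hη0 : ∀ x ∉ Icc (-(R : ℝ)) R, η x = 0 := by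
    intro x hx
    simp only [hη, hφ, hF]
    rcases not_and_or.mp hx with h | h
    · have hx' : x < -(R : ℝ) := not_le.mp h
      rw [ascSlot_of_lt_neg hR₂ hx', arcsineCDF_of_le_neg ha0 (by linarith)]; ring
    · have hx' : (R : ℝ) < x := not_le.mp h
      rw [ascSlot_of_le hx'.le, arcsineCDF_of_le ha0 (by linarith)]; ring
  have hηint : Integrable η := integrable_of_bounded_Icc hηm hηC hη0
  have hRR : -(R : ℝ) ≤ R := by linarith
  have hred : ∀ {g : ℝ → ℝ}, (∀ x ∉ Icc (-(R : ℝ)) R, g x = 0) → ∫ x, g x = ∫ x in (-(R : ℝ))..R, g x := by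
    intro g hg
    rw [integral_of_le hRR, ← integral_Icc_eq_integral_Ioc]
    exact (setIntegral_eq_integral_of_forall_compl_eq_zero fun x hx => hg x hx).symm
  -- charge neutrality `∫ η = 0`
  have hint0 : ∫ x, η x = 0 := by
    rw [hred hη0]
    simp only [hη, hφ, hF]
    rw [intervalIntegral.integral_sub (intervalIntegrable_ascSlot R _ _)
      ((continuous_arcsineCDF a).intervalIntegrable _ _), integral_ascSlot hR₂, integral_arcsineCDF]
    ring
  -- equal areas `∫ x η(x) dx = 0`
  have hint1 : ∫ x, x * η x = 0 := by
    rw [hred (g := fun x => x * η x) fun x hx => by rw [hη0 x hx, mul_zero] ]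
    have hsplit : ∀ x, x * η x = x * ascSlot Y R x - x * arcsineCDF a x := fun x => by
      simp only [hη, hφ, hF]; ring
    simp_rw [hsplit]
    have hi1 : IntervalIntegrable (fun x => x * ascSlot Y R x) volume (-(R : ℝ)) R :=
      (intervalIntegrable_ascSlot R _ _).continuousOn_mul continuous_id.continuousOn
    have hi2 : IntervalIntegrable (fun x => x * arcsineCDF a x) volume (-(R : ℝ)) R :=
      (continuous_id.mul (continuous_arcsineCDF a)).intervalIntegrable _ _
    rw [intervalIntegral.integral_sub hi1 hi2,
      integral_id_mul_ascSlot hR₁ hR₂, integral_id_mul_arcsineCDF ha0 haR, hcard, ha]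
    nlinarith [hsq]
  -- signs outside `[-a, a]`
  have hpos : ∀ x, x < -a → 0 ≤ η x := fun x hx => by
    simp only [hη, hφ, hF]
    rw [arcsineCDF_of_le_neg ha0 hx.le, sub_zero]; exact ascSlot_nonneg R x
  have hneg : ∀ x, a < x → η x ≤ 0 := fun x hx => by
    simp only [hη, hφ, hF]
    rw [arcsineCDF_of_le ha0 hx.le]; linarith [ascSlot_le_one (Y := Y) R x]
  -- the diagonal slots
  set m : ℕ := ⌊a⌋₊ with hm
  set KA : Finset ℤ := (Finset.range m).image (fun j : ℕ => (j : ℤ)) with hKA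
  set KB : Finset ℤ := (Finset.range m).image (fun j : ℕ => -(j : ℤ) - 1) with hKB
  set K : Finset ℤ := KA ∪ KB with hK
  set nn : ℤ → ℝ := fun k => min (F k) (1 - F ((k : ℝ) + 1)) with hnn
  have hn : ∀ k ∈ K, 0 ≤ nn k := fun k _ =>
    le_min (arcsineCDF_nonneg a k) (sub_nonneg.mpr (arcsineCDF_le_one a _))
  have hsgn : ∀ k ∈ K, (∀ y ∈ Ioo (k : ℝ) (k + 1), nn k ≤ η y) ∨
      (∀ y ∈ Ioo (k : ℝ) (k + 1), η y ≤ -nn k) := by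
    intro k _
    have hfl : ∀ y ∈ Ioo (k : ℝ) (k + 1), φ y = φ k := fun y hy => by
      simp only [hφ]
      rw [ascSlot_eq_floor R y, Int.floor_eq_iff.mpr ⟨hy.1.le, hy.2⟩]
    rcases ascSlot_eq_zero_or_one (Y := Y) R (k : ℝ) with hc | hc
    · right
      intro y hy
      have hφy : φ y = 0 := (hfl y hy).trans hc
      have hmono := monotone_arcsineCDF ha0 hy.1.le
      simp only [hη, hφy, hnn, hF] at hmono ⊢
      have := min_le_left (arcsineCDF a k) (1 - arcsineCDF a ((k : ℝ) + 1))
      linarith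
    · left
      intro y hy
      have hφy : φ y = 1 := (hfl y hy).trans hc
      have hmono := monotone_arcsineCDF ha0 hy.2.le
      simp only [hη, hφy, hnn, hF] at hmono ⊢
      have := min_le_right (arcsineCDF a k) (1 - arcsineCDF a ((k : ℝ) + 1))
      linarith
  -- `∑_{k ∈ K} n_k² = S_N / 4`
  have hsum : ∑ k ∈ K, nn k ^ 2 = vkDiagSum N / 4 := by
    have hdisj : Disjoint KA KB := by
      rw [Finset.disjoint_left]
      intro k h1 h2
      obtain ⟨j, -, rfl⟩ := Finset.mem_image.mp h1
      obtain ⟨j', -, hj'⟩ := Finset.mem_image.mp h2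
      omega
    rw [hK, Finset.sum_union hdisj, hKA, hKB,
      Finset.sum_image fun j _ j' _ h => by exact_mod_cast h,
      Finset.sum_image fun j _ j' _ h => by simpa using h]
    have hA : ∀ j : ℕ, nn (j : ℤ) ^ 2 = vkPsi (((j : ℝ) + 1) / a) / 4 := fun j => by
      simp only [hnn, hF, Int.cast_natCast]
      exact (arcsineCDF_slot_sq ha0 j).1
    have hB : ∀ j : ℕ, nn (-(j : ℤ) - 1) ^ 2 = vkPsi (((j : ℝ) + 1) / a) / 4 := fun j => by
      simp only [hnn, hF]
      push_cast
      exact (arcsineCDF_slot_sq ha0 j).2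
    simp_rw [hA, hB]
    rw [vkDiagSum, ← ha, ← hm, Finset.sum_Ico_eq_sum_range, Nat.add_sub_cancel]
    rw [← Finset.sum_add_distrib, Finset.mul_sum, Finset.sum_div]
    refine Finset.sum_congr rfl fun j _ => ?_
    push_cast
    ring_nf
  -- the four analytic inputs
  have hQ1 := integral_sq_div_sq_le_neg_logEnergy hηm hηC hη0 hR0 hint0
  have hQ2 := sum_sq_div_two_le_integral_sq_div_sq hηm hηC hη0 hR0 K nn hn hsgn
  have hB1 := hookForm_self_eq_half_logEnergy hηm hηC hη0 hR0
  have hLin : 0 ≤ (∫ p : ℝ × ℝ, upperLogKernel p * η p.1 * (1 - arcsineCDF a p.2)) -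
      ∫ p : ℝ × ℝ, upperLogKernel p * arcsineCDF a p.1 * η p.2 := by
    rw [hookForm_linear_eq hηm hηC hη0 hR0 ha0]
    exact integral_mul_arcsineLinPot_nonneg hηm hηC hη0 ha0 hint0 hint1 hpos hneg
  have hΩ : ∫ p : ℝ × ℝ, upperLogKernel p * arcsineCDF a p.1 * (1 - arcsineCDF a p.2) =
      ((N : ℝ) * Real.log N - N) / 2 := by
    rw [hookForm_arcsine ha0, ha, show 2 * Real.sqrt N / 2 = Real.sqrt N by ring,
      Real.log_sqrt hN0.le, show (2 * Real.sqrt (N : ℝ)) ^ 2 / 4 = N by rw [mul_pow, hsq]; ring]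
    ring
  have hexp := hookForm_expand ha0 haR hηm hηC hη0 (φ := φ) (fun x => by simp only [hη]; ring)
  have hJ : vkJCells μ = ∫ p : ℝ × ℝ, upperLogKernel p * φ p.1 * (1 - φ p.2) := by
    rw [vkJCells, sum_vkHookKernel_eq_hookForm hR₁ hR₂]
    refine integral_congr_ae (Eventually.of_forall fun p => ?_)
    simp only [hφ]
    rw [← ascSlot_add_descSlot hR₁ hR₂ p.2]
    ring
  rw [hJ, hexp, hΩ, hB1, hsum] at *
  rw [hsum] at hQ2
  linarith

/-- **Vershik–Kerov 1985: the two-sided bound for the largest dimension of an irreducible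
representation of `𝔖ₙ`,
`√(n!) e^{-(c₁+ε)√n} ≤ D(n) ≤ √(n!) e^{-(c₂-ε)√n}` for large `n`, `c₁ = π/√6`, `c₂ = (π-2)/π²`**
(as quoted in Pak–Panova–Yeliussizov 2019, §2.3 (2.3)–(2.4)) — the named fact
`VershikKerov1985_maxCharDegree` DISCHARGED: the lower half and the reduction to (LSVK) are the
tree's `VershikKerov1985_maxCharDegree_of_hookIntegral_bound`, and (LSVK) is `lsvk_inequality`.
[cite: VershikKerov1985, Thm. 1 (as quoted in Pak–Panova–Yeliussizov 2019, arXiv:1804.04693, §2.3 eq. (2.3))] -/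
theorem VershikKerov1985_maxCharDegree_holds : VershikKerov1985_maxCharDegree :=
  VershikKerov1985_maxCharDegree_of_hookIntegral_bound fun N hN μ => lsvk_inequality N hN μ

end Literature.RepresentationTheory.FiniteGroups

end
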